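import Literature.AlgebraicGeometry.Resolution.DifferentialOperators
import Mathlib.Algebra.CharP.Lemmas
import Mathlib.Algebra.CharP.Reduced
import Mathlib.FieldTheory.Perfect
import HarnessLib

/-!
# The Frobenius transport `σ = ρ^ℓ ∂ ρ^{−ℓ}` of a differential operator to the subalgebra of `p^ℓ`-th powers

Topic `Literature/AlgebraicGeometry/Resolution`, companion of `DifferentialOperators.lean` (EGA IV₄ §16.8: the predicate
`IsDiffOpLE R n D`, commutator recursion 16.8.8 (b)) and `DiffOpFrobeniusLinear.lean`. Setting: `𝕂` a perfect field of
characteristic `p`, `A` a REDUCED commutative `𝕂`-algebra of characteristic `p`, `q = p^ℓ`, and `S ⊆ A` the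
`𝕂`-subalgebra of `q`-th powers (`f ∈ S ↔ ∃ g, g^q = f`; `S = ρ^ℓ(A)`, `ρ` the Frobenius). Since `ρ^ℓ : A → S` is then a
BIJECTION, every `𝕂`-linear `∂ : A → A` has a unique transport `σ : S → S`, `σ(g^q) = (∂g)^q` — Hironaka's
«`σ = ρ^ℓ∂ρ^{−ℓ}`, the differential operator in `ρ^ℓ(O_ξ)`» (ms. 2017, proof of Lem. 7.10, p.38 l.6). This file proves:

* `exists_frobeniusTransport` — existence of a `𝕂`-LINEAR `σ : S →ₗ[𝕂] S` with `σ(g^q) = (∂g)^q` (additivity from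
  `(a+b)^q = a^q + b^q`; `𝕂`-linearity from the perfectness of `𝕂`: `c = c′^q`);
* `frobeniusTransport_unique` — two such `σ` coincide (every element of `S` is a `q`-th power);
* `isDiffOpLE_frobeniusTransport` — **if `∂ ∈ Diff^{≤ m}_{A/𝕂}` then `σ ∈ Diff^{≤ m}_{S/𝕂}`**: the commutator of `σ`
  with `a^q ∈ S` is the transport of `[∂, a]` (`[σ, a^q](g^q) = (∂(ag) − a∂g)^q`), so EGA's recursion 16.8.8 (b)
  descends along the transport (induction on `m`).

Bearing (index only; nothing of it is asserted): H. Hironaka, *Resolution of singularities in positive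
characteristics* (ms. 2017), p.38 l.6–8 (typed `Hironaka2017.S07Permissible.U38L6`, part (i), HIRONAKA-L Q-07-028),
Def. 3.7 / Lem. 3.6 p.9–10 (`S03DiffARNE`). The `x`-Cartier EXTENSION of `σ` (Lem. 3.6) is not treated here.

## References
* A. Grothendieck, J. Dieudonné, ÉGA IV₄, Publ. Math. IHÉS 32 (1967), §16.8, Déf. 16.8.1, Prop. 16.8.8 (b). [EGAIV4]
* H. Hironaka, ms. 2017-03-23, p.38 l.6 «let `σ` be the differential operator in `ρ^ℓ(O_ξ)` which is `σ = ρ^ℓ∂ρ^{−ℓ}`».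
  [Hironaka2017] (unrefereed manuscript under adjudication — kernel support, nothing of the manuscript asserted)
-/

namespace Literature.AlgebraicGeometry.Resolution

universe u v

section Transport

variable {𝕂 : Type u} [Field 𝕂] {A : Type v} [CommRing A] [Algebra 𝕂 A] (p : ℕ) [Fact p.Prime]

/-- In a reduced ring of characteristic `p` the map `g ↦ g^{p^ℓ}` is injective (Mathlib `iterateFrobenius_inj`,
restated for bare powers). [folklore] -/
private theorem pow_char_pow_injective' [CharP A p] [IsReduced A] (ℓ : ℕ) :
    Function.Injective fun g : A => g ^ p ^ ℓ := by
  haveI : ExpChar A p := ExpChar.prime (Fact.out : p.Prime)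
  intro a b h
  exact iterateFrobenius_inj A p ℓ (by simpa only [iterateFrobenius_def] using h)

/-- **Existence of the Frobenius transport** `σ = ρ^ℓ∂ρ^{−ℓ}`: for every `𝕂`-linear `∂ : A → A` there is a `𝕂`-linear
`σ : S → S` on the subalgebra `S = ρ^ℓ(A)` of `p^ℓ`-th powers with `σ(g^{p^ℓ}) = (∂g)^{p^ℓ}` for all `g` (`A` reduced of
characteristic `p`, so `ρ^ℓ : A → S` is bijective; `𝕂` perfect, so `σ` is `𝕂`-linear: `c·g^q = (c^{1/q} g)^q`).
[cite: Hironaka2017, p.38 l.6 «σ = ρ^ℓ∂ρ^{−ℓ}» (unrefereed manuscript under adjudication — kernel support, nothing of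
the manuscript asserted)] -/
theorem exists_frobeniusTransport [CharP 𝕂 p] [PerfectRing 𝕂 p] [CharP A p] [IsReduced A] (ℓ : ℕ)
    (S : Subalgebra 𝕂 A) (hS : ∀ f : A, f ∈ S ↔ ∃ g : A, g ^ p ^ ℓ = f) (D : A →ₗ[𝕂] A) :
    ∃ σ : S →ₗ[𝕂] S, ∀ (g : A) (hg : g ^ p ^ ℓ ∈ S), (σ ⟨g ^ p ^ ℓ, hg⟩ : A) = (D g) ^ p ^ ℓ := by
  haveI : ExpChar A p := ExpChar.prime (Fact.out : p.Prime)
  have hinj := pow_char_pow_injective' (A := A) p ℓ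
  choose root hroot using fun s : S => (hS _).mp s.2
  -- `root s` is THE `q`-th root: characterisation
  have root_eq : ∀ (s : S) (g : A), g ^ p ^ ℓ = (s : A) → root s = g := by
    intro s g hg
    exact hinj (by simp only [hroot s, hg])
  have hmem : ∀ g : A, (D g) ^ p ^ ℓ ∈ S := fun g => (hS _).mpr ⟨D g, rfl⟩
  refine ⟨{ toFun := fun s => ⟨(D (root s)) ^ p ^ ℓ, hmem _⟩
            map_add' := ?_
            map_smul' := ?_ }, ?_⟩
  · intro s t
    apply Subtype.ext
    change (D (root (s + t))) ^ p ^ ℓ = (D (root s)) ^ p ^ ℓ + (D (root t)) ^ p ^ ℓ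
    have h : root (s + t) = root s + root t := by
      refine root_eq (s + t) (root s + root t) ?_
      rw [add_pow_expChar_pow, hroot, hroot, Subalgebra.coe_add]
    rw [h, map_add, add_pow_expChar_pow]
  · intro c s
    apply Subtype.ext
    change (D (root (c • s))) ^ p ^ ℓ = ((c • (⟨(D (root s)) ^ p ^ ℓ, hmem _⟩ : S) : S) : A)
    rw [Subalgebra.coe_smul]
    -- `c = c'^q` in the perfect field `𝕂`
    obtain ⟨c', hc'⟩ := (bijective_iterateFrobenius 𝕂 p ℓ).2 c
    rw [iterateFrobenius_def] at hc'
    have h : root (c • s) = c' • root s := by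
      refine root_eq (c • s) (c' • root s) ?_
      rw [Subalgebra.coe_smul, smul_pow, hroot, hc']
    rw [h, LinearMap.map_smul, smul_pow, hc']
  · intro g hg
    change (D (root ⟨g ^ p ^ ℓ, hg⟩)) ^ p ^ ℓ = (D g) ^ p ^ ℓ
    rw [root_eq ⟨g ^ p ^ ℓ, hg⟩ g rfl]

omit [Fact p.Prime] in
/-- **Uniqueness of the Frobenius transport**: two `𝕂`-linear maps `S → S` with `σ(g^{p^ℓ}) = (∂g)^{p^ℓ}` for all `g`
coincide, since every element of `S = ρ^ℓ(A)` is a `p^ℓ`-th power. [cite: Hironaka2017, p.38 l.6 «σ = ρ^ℓ∂ρ^{−ℓ}»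
(unrefereed manuscript under adjudication — kernel support, nothing of the manuscript asserted)] -/
theorem frobeniusTransport_unique (ℓ : ℕ) (S : Subalgebra 𝕂 A) (hS : ∀ f : A, f ∈ S ↔ ∃ g : A, g ^ p ^ ℓ = f)
    (D : A →ₗ[𝕂] A) {σ σ' : S →ₗ[𝕂] S}
    (hσ : ∀ (g : A) (hg : g ^ p ^ ℓ ∈ S), (σ ⟨g ^ p ^ ℓ, hg⟩ : A) = (D g) ^ p ^ ℓ)
    (hσ' : ∀ (g : A) (hg : g ^ p ^ ℓ ∈ S), (σ' ⟨g ^ p ^ ℓ, hg⟩ : A) = (D g) ^ p ^ ℓ) : σ = σ' := by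
  refine LinearMap.ext fun s => ?_
  obtain ⟨g, hg⟩ := (hS _).mp s.2
  have hs : s = ⟨g ^ p ^ ℓ, hg.symm ▸ s.2⟩ := Subtype.ext hg.symm
  rw [hs]
  exact Subtype.ext ((hσ g _).trans (hσ' g _).symm)

/-- The commutator of a transport with a `p^ℓ`-th power is the transport of the commutator:
`[σ, a^{p^ℓ}](g^{p^ℓ}) = ([∂, a] g)^{p^ℓ}` (`= (∂(ag) − a·∂g)^{p^ℓ}`, characteristic `p`).
[cite: EGAIV4, Prop. 16.8.8 (16.8.8.1)] -/
theorem commMul_frobeniusTransport_apply [CharP A p] (ℓ : ℕ) (S : Subalgebra 𝕂 A)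
    (hS : ∀ f : A, f ∈ S ↔ ∃ g : A, g ^ p ^ ℓ = f) (D : A →ₗ[𝕂] A) {σ : S →ₗ[𝕂] S}
    (hσ : ∀ (g : A) (hg : g ^ p ^ ℓ ∈ S), (σ ⟨g ^ p ^ ℓ, hg⟩ : A) = (D g) ^ p ^ ℓ)
    (a : A) (ha : a ^ p ^ ℓ ∈ S) (g : A) (hg : g ^ p ^ ℓ ∈ S) :
    (commMul 𝕂 σ ⟨a ^ p ^ ℓ, ha⟩ ⟨g ^ p ^ ℓ, hg⟩ : A) = (commMul 𝕂 D a g) ^ p ^ ℓ := by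
  haveI : ExpChar A p := ExpChar.prime (Fact.out : p.Prime)
  have hag : (a * g) ^ p ^ ℓ ∈ S := (hS _).mpr ⟨a * g, rfl⟩
  have hprod : (⟨a ^ p ^ ℓ, ha⟩ : S) * ⟨g ^ p ^ ℓ, hg⟩ = ⟨(a * g) ^ p ^ ℓ, hag⟩ := by
    apply Subtype.ext
    change a ^ p ^ ℓ * g ^ p ^ ℓ = (a * g) ^ p ^ ℓ
    rw [mul_pow]
  rw [commMul_apply, Subalgebra.coe_sub, Subalgebra.coe_mul, hprod, hσ, hσ, commMul_apply, sub_pow_expChar_pow,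
    mul_pow]

/-- **The transport of a differential operator of order `≤ m` is a differential operator of order `≤ m`** on
`S = ρ^ℓ(A)` over `𝕂`: EGA's recursion «`∂` of order `≤ m + 1` iff every `[∂, a]` of order `≤ m`» (16.8.8 (b)) passes
through `σ(g^q) = (∂g)^q` because `[σ, a^q]` is the transport of `[∂, a]` (`commMul_frobeniusTransport_apply`) and
every element of `S` is an `a^q`. Valid for ANY `𝕂`-linear `σ` satisfying the transport identity.
[cite: EGAIV4, Prop. 16.8.8 (b); Hironaka2017, p.38 l.6 «σ … the differential operator in ρ^ℓ(O_ξ)» (unrefereed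
manuscript under adjudication — kernel support, nothing of the manuscript asserted)] -/
theorem isDiffOpLE_frobeniusTransport [CharP A p] (ℓ : ℕ) (S : Subalgebra 𝕂 A)
    (hS : ∀ f : A, f ∈ S ↔ ∃ g : A, g ^ p ^ ℓ = f) :
    ∀ (m : ℕ) (D : A →ₗ[𝕂] A) (σ : S →ₗ[𝕂] S), IsDiffOpLE 𝕂 m D →
      (∀ (g : A) (hg : g ^ p ^ ℓ ∈ S), (σ ⟨g ^ p ^ ℓ, hg⟩ : A) = (D g) ^ p ^ ℓ) → IsDiffOpLE 𝕂 m σ := by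
  haveI : ExpChar A p := ExpChar.prime (Fact.out : p.Prime)
  have hq : p ^ ℓ ≠ 0 := pow_ne_zero ℓ (Fact.out : p.Prime).ne_zero
  intro m
  induction m with
  | zero =>
    intro D σ hD hσ s₀
    obtain ⟨a, ha⟩ := (hS _).mp s₀.2
    have hs₀ : s₀ = ⟨a ^ p ^ ℓ, ha.symm ▸ s₀.2⟩ := Subtype.ext ha.symm
    refine LinearMap.ext fun s => ?_
    obtain ⟨g, hg⟩ := (hS _).mp s.2
    have hs : s = ⟨g ^ p ^ ℓ, hg.symm ▸ s.2⟩ := Subtype.ext hg.symm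
    rw [hs₀, hs, LinearMap.zero_apply]
    apply Subtype.ext
    rw [commMul_frobeniusTransport_apply p ℓ S hS D hσ, hD a, LinearMap.zero_apply, Subalgebra.coe_zero,
      zero_pow hq]
  | succ m ih =>
    intro D σ hD hσ s₀
    obtain ⟨a, ha⟩ := (hS _).mp s₀.2
    have hs₀ : s₀ = ⟨a ^ p ^ ℓ, ha.symm ▸ s₀.2⟩ := Subtype.ext ha.symm
    rw [hs₀]
    refine ih (commMul 𝕂 D a) _ (hD a) fun g hg => ?_
    exact commMul_frobeniusTransport_apply p ℓ S hS D hσ a _ g hg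

/-- **Part (i) of Hironaka's sentence p.38 l.6–8, as one statement**: for a differential operator `∂ ∈ Diff^{≤ m}_{A/𝕂}`
of the reduced `𝕂`-algebra `A` of characteristic `p` (`𝕂` perfect) there is a `𝕂`-linear `σ` on `S = ρ^ℓ(A)` with
`σ(g^{p^ℓ}) = (∂g)^{p^ℓ}`, and it is a differential operator of `S/𝕂` (of order `≤ m`). [cite: Hironaka2017, p.38
l.6 «let σ be the differential operator in ρ^ℓ(O_ξ) which is σ = ρ^ℓ∂ρ^{−ℓ}» (unrefereed manuscript under adjudication —
kernel support, nothing of the manuscript asserted)] -/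
theorem exists_frobeniusTransport_isDiffOpLE [CharP 𝕂 p] [PerfectRing 𝕂 p] [CharP A p] [IsReduced A] (ℓ : ℕ)
    (S : Subalgebra 𝕂 A) (hS : ∀ f : A, f ∈ S ↔ ∃ g : A, g ^ p ^ ℓ = f) {m : ℕ} {D : A →ₗ[𝕂] A}
    (hD : IsDiffOpLE 𝕂 m D) :
    ∃ σ : S →ₗ[𝕂] S, (∀ (g : A) (hg : g ^ p ^ ℓ ∈ S), (σ ⟨g ^ p ^ ℓ, hg⟩ : A) = (D g) ^ p ^ ℓ) ∧
      IsDiffOpLE 𝕂 m σ := by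
  obtain ⟨σ, hσ⟩ := exists_frobeniusTransport p ℓ S hS D
  exact ⟨σ, hσ, isDiffOpLE_frobeniusTransport p ℓ S hS m D σ hD hσ⟩

end Transport

end Literature.AlgebraicGeometry.Resolution
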